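import Mathlib
import HarnessLib

/-!
# Crux `TransferPB` (stmt-QuantumAdvantage-15238, route SosSandwich), line `birth` — a mean estimate from gapped threshold answers

Toolkit lemma for the MACHINE half of stub `stub_pbOracleSimulation` (see
`Theorems/SosSandwichTransferPBMachineReduction{,Pick}.lean`: the transcript machine must deliver a
`1/20`-accurate estimate `est ρ` of the mean `E[p_x|_ρ] ∈ [0,1]` of a restricted acceptance probability, but a
promise oracle only answers GAPPED THRESHOLD questions "`E ≥ j/m`?" — forced to `true` when `E ≥ j/m`, to
`false` when `E ≤ (j-1)/m`, arbitrary in between). The simplest machine asks the `m` questions `j = 1, …, m`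
(non-adaptively) and outputs `#{j : answer = true}/m`. This file proves that this count is `1/m`-accurate
WHATEVER the answers inside the gaps are (`abs_thresholdCount_div_sub_le`; with `m = 40` the precision is
`1/40 ≤ 1/20`, `thresholdCount_forty`). Pure real arithmetic, encoding-free; no named fact.
Source: S. Aaronson, A. Ambainis, Theory Comput. 10 (2014), proof of Thm. 23 (p. 14: `E[p_j]` need only be
estimated); the counting device is folklore.
-/

-- D-0017: single-conjunct summit ⇒ the duplicate `QuantumAdvantage.QuantumAdvantage` is mandated.
set_option linter.dupNamespace false

namespace Summit.QuantumAdvantage.QuantumAdvantage.Cruxes.TransferPB.Birth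

namespace SimTreePB

open Finset

/-- **A mean estimate from gapped threshold answers.** Let `E ∈ [0,1]`, `m ≥ 1`, and let `ans j` (`1 ≤ j ≤ m`)
be answers to "`E ≥ j/m`?" that are correct outside the gaps: `ans j = true` whenever `j/m ≤ E` and
`ans j = false` whenever `E ≤ (j-1)/m`. Then `|#{j ∈ [1,m] : ans j = true}/m − E| ≤ 1/m`: with `k = ⌊mE⌋`,
the answers `1, …, k` are forced to `true` and the answers `k+2, …, m` to `false`. [folklore] -/
theorem abs_thresholdCount_div_sub_le {E : ℝ} (hE0 : 0 ≤ E) (hE1 : E ≤ 1) {m : ℕ} (hm : 0 < m)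
    (ans : ℕ → Bool)
    (hyes : ∀ j ∈ Icc 1 m, (j : ℝ) / m ≤ E → ans j = true)
    (hno : ∀ j ∈ Icc 1 m, E ≤ ((j : ℝ) - 1) / m → ans j = false) :
    |(((Icc 1 m).filter fun j => ans j = true).card : ℝ) / m - E| ≤ 1 / m := by
  have hmR : (0 : ℝ) < m := by exact_mod_cast hm
  set S := (Icc 1 m).filter fun j => ans j = true with hS
  set k : ℕ := Nat.floor ((m : ℝ) * E) with hk
  have hmE0 : 0 ≤ (m : ℝ) * E := by positivity
  have hk_le : (k : ℝ) ≤ (m : ℝ) * E := Nat.floor_le hmE0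
  have hk_lt : (m : ℝ) * E < k + 1 := Nat.lt_floor_add_one _
  have hkm : k ≤ m := by
    have : (k : ℝ) ≤ m := hk_le.trans (by nlinarith)
    exact_mod_cast this
  -- (i) the first `k` answers are forced to `true`
  have hlow : Icc 1 k ⊆ S := by
    intro j hj
    rw [mem_Icc] at hj
    have hjm : j ∈ Icc 1 m := mem_Icc.2 ⟨hj.1, hj.2.trans hkm⟩
    have hjE : (j : ℝ) / m ≤ E := by
      rw [div_le_iff₀ hmR]
      have : (j : ℝ) ≤ k := by exact_mod_cast hj.2
      linarith
    exact mem_filter.2 ⟨hjm, hyes j hjm hjE⟩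
  -- (ii) the answers beyond `k + 1` are forced to `false`
  have hhigh : S ⊆ Icc 1 (k + 1) := by
    intro j hj
    obtain ⟨hjm, hja⟩ := mem_filter.1 hj
    rw [mem_Icc] at hjm ⊢
    refine ⟨hjm.1, ?_⟩
    by_contra hgt
    have hj2 : k + 2 ≤ j := by omega
    have hjE : E ≤ ((j : ℝ) - 1) / m := by
      rw [le_div_iff₀ hmR]
      have : (k : ℝ) + 2 ≤ j := by exact_mod_cast hj2
      linarith
    have := hno j (mem_Icc.2 hjm) hjE
    rw [this] at hja
    exact Bool.false_ne_true hja
  have hcard_low : k ≤ S.card := by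
    have := card_le_card hlow
    simpa using this
  have hcard_high : S.card ≤ k + 1 := by
    have := card_le_card hhigh
    simpa using this
  have h1 : (k : ℝ) ≤ S.card := by exact_mod_cast hcard_low
  have h2 : (S.card : ℝ) ≤ k + 1 := by exact_mod_cast hcard_high
  rw [div_sub' (ne_of_gt hmR), abs_div, abs_of_pos hmR]
  refine div_le_div_of_nonneg_right ?_ hmR.le
  rw [abs_le]
  constructor <;> nlinarith

/-- **Forty thresholds give precision `1/20`** (the instance used by the machine reduction, whose leaf values
must be `1/20`-accurate). [folklore] -/
theorem thresholdCount_forty {E : ℝ} (hE0 : 0 ≤ E) (hE1 : E ≤ 1) (ans : ℕ → Bool)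
    (hyes : ∀ j : ℕ, j ∈ Icc 1 40 → (j : ℝ) / 40 ≤ E → ans j = true)
    (hno : ∀ j : ℕ, j ∈ Icc 1 40 → E ≤ ((j : ℝ) - 1) / 40 → ans j = false) :
    |(((Icc (1 : ℕ) 40).filter fun j => ans j = true).card : ℝ) / 40 - E| ≤ 1 / 20 := by
  have h := abs_thresholdCount_div_sub_le hE0 hE1 (by norm_num : 0 < 40) ans
    (by exact_mod_cast hyes) (by exact_mod_cast hno)
  have h40 : ((40 : ℕ) : ℝ) = 40 := by norm_num
  rw [h40] at h
  linarith [h]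

end SimTreePB

end Summit.QuantumAdvantage.QuantumAdvantage.Cruxes.TransferPB.Birth
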